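import Literature.MathematicalPhysics.QuantumFieldTheory.Balaban1983to89.B4Thm19ZeroLattice
import Literature.MathematicalPhysics.QuantumFieldTheory.Balaban1983to89.B4Thm110ZeroLattice
import HarnessLib

/-!
# The block-mass shadow of the Coulomb chart, flat: `∂^η G_k(0) ∂^{η*}` is bounded on `ℓ^∞` with NO `log N`

M-COUL step 1 (LEAD ★w1-19936 g8, 2026-08-29): the FLAT, ONE-OPERATOR form of «the averaging constraint is a mass at the
block scale». For Bałaban's zero-field propagator `G_k(0) = (−Δ^η + m² + a_kQ_k^*Q_k)⁻¹` on the whole lattice `ηℤ^{d+1}`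
(`η = L^{−k}`, `n = L^k` fine points per block side, `Q_k` = block averaging; the tree's `B3GkZeroLattice.GkLat` in matrix units,
Green identity `green_GkLat`), and a bounded bond function `f` (`‖f(z,ν)‖ ≤ F_∞`), the gradient of `h := G_k(0)∂^{η*}f` obeys

  `‖(∂^η_μ h)(x)‖ ≤ 2(d+1)·c₀·n·F_∞`   for every `x`, every axis `μ`,

with the constant `c₀ = c₀(d, L, window)` of the tree's (1.10) derivative clause
(`B4Thm19ZeroLattice.GkLat_weightedRowD_le`) — no box, no volume, no `log N`: compare the flat Riesz transform `∇Δ⁻¹∂*`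
of `PoincareLipschitzFlatRieszLog`, which costs `log₂(N+1)+1` on a box of radius `N`. The proof is a citation knit:
`‖∂^{η*}f‖_∞ ≤ 2(d+1)n‖f‖_∞` (`norm_adjDiv_le`) composed with the `ℓ^∞ → ℓ^∞` bound of `∂^η_μG_k(0)`
(`B4Thm19ZeroLattice.GkLatD_apply_le` at `D = 0`). For finitely supported `f` the same `h` is THE solution of
`(−Δ^ξ + m² + a_kQ_k^*Q_k)h = ∂^{η*}f` in the operator letters `B4Green244.opD` (`B4Thm110ZeroLattice.GkLat_apply_finsupp`), and
its gradient is the finite sum (`blockMass_solution_gradient_le`).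

UNITS. `∂^η_μφ(x) = n(φ(x+e_μ) − φ(x))`, `(∂^{η*}f)(z) = Σ_ν n(f(z−e_ν,ν) − f(z,ν))` (fine units, the adjoint-difference
convention of `B4Thm19ZeroLattice.GkLat_adjDeriv_apply_l1_le`). The composite `∂^ηG_k(0)∂^{η*}` is scale-free, so in
lattice letters this is `sup|∇h| ≤ C·sup|f|` for `(−Δ + (m∕n)² + (a_k∕n²)·Q_n^*Q_n)h = ∂*f` with blocks of side `n`; at ONE
level (`k = 1`, `n = L`) the constant is `2(d+1)c₀L = C(d, L, window)`.

HONEST. The factor `n` is CRUDE: the true `ℓ^∞ → ℓ^∞` norm of `∂G_k(0)∂*` is `≍ log n = k·log L` (the Calderón–Zygmund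
kernel `|∂_x∂_zG| ≍ |x−z|^{−(d+1)}` below the block scale, exponential decay above it): the block mass caps the Riesz
logarithm at the block scale, it does not remove the short-distance one. The sharp form (RIESZ-LOG-FLAT on `Q_n(x)` spliced
with (1.10) beyond `n`) is not in this file. Flat (`A = 0`), scalar, zero-field lineage only; nothing covariant, nothing of
the Yang–Mills tower, `HistoryTailL`, `BlockLipschitzL` or any stub is proved here; YM₃ on T³ is rung R3, not the Clay problem.
[cite: Balaban1983RegularityDecay, Theorem (Prop. 2.1 of [1]) (1.10) p.573, Lemma 2.2 (2.17) p.578; Balaban1984PropagatorsII, (1.9) p.226]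
-/

open scoped BigOperators
open Finset

namespace Summit.QuantumFields.YangMills.Theorems.PoincareLipschitzFlatBlockMassRiesz

open Literature.MathematicalPhysics.QuantumFieldTheory.Balaban1983to89
open B4ContourShift (supNorm supNorm_nonneg)
open B3GkZeroLattice (GkLat)
open B4Green244 (opD)
open B4Thm19ZeroLattice (GkLat_weightedRowD_le GkLatD_apply_le)
open B4Thm110ZeroLattice (GkLat_apply_finsupp)

variable {d : ℕ}

/-! ## §1 The adjoint difference (lattice divergence) of a bounded bond function -/

/-- `‖(∂^{η*}f)(z)‖ = ‖Σ_ν n(f(z−e_ν,ν) − f(z,ν))‖ ≤ 2(d+1)·n·F_∞` when `‖f(z,ν)‖ ≤ F_∞`. [folklore] -/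
theorem norm_adjDiv_le (n : ℕ) {f : (Fin (d + 1) → ℤ) → Fin (d + 1) → ℂ} {Fsup : ℝ} (hf : ∀ z ν, ‖f z ν‖ ≤ Fsup)
    (z : Fin (d + 1) → ℤ) :
    ‖∑ ν, (n : ℂ) * (f (z - Pi.single ν 1) ν - f z ν)‖ ≤ 2 * ((d : ℝ) + 1) * n * Fsup := by
  calc ‖∑ ν, (n : ℂ) * (f (z - Pi.single ν 1) ν - f z ν)‖
      ≤ ∑ ν, ‖(n : ℂ) * (f (z - Pi.single ν 1) ν - f z ν)‖ := norm_sum_le _ _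
    _ ≤ ∑ _ν : Fin (d + 1), (n : ℝ) * (2 * Fsup) := Finset.sum_le_sum fun ν _ => by
        rw [norm_mul, Complex.norm_natCast]
        refine mul_le_mul_of_nonneg_left ?_ (Nat.cast_nonneg _)
        calc ‖f (z - Pi.single ν 1) ν - f z ν‖ ≤ ‖f (z - Pi.single ν 1) ν‖ + ‖f z ν‖ := norm_sub_le _ _
          _ ≤ Fsup + Fsup := add_le_add (hf _ _) (hf _ _)
          _ = 2 * Fsup := by ring
    _ = 2 * ((d : ℝ) + 1) * n * Fsup := by
        rw [Finset.sum_const, Finset.card_univ, Fintype.card_fin, nsmul_eq_mul]; push_cast; ring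

/-- the adjoint difference of a bond function vanishing off `S` vanishes off `S ∪ ⋃_ν (S + e_ν)`; in the consumer's shape:
if `f(z,ν) = 0` whenever `z ∉ S`, and `S' ⊇ S` contains `z + e_ν` for all `z ∈ S`, then `(∂^{η*}f)(z) = 0` for `z ∉ S'`. [folklore] -/
theorem adjDiv_eq_zero_of_support (n : ℕ) {f : (Fin (d + 1) → ℤ) → Fin (d + 1) → ℂ} {S S' : Finset (Fin (d + 1) → ℤ)}
    (hfS : ∀ z ∉ S, ∀ ν, f z ν = 0) (hSS' : S ⊆ S') (hshift : ∀ z ∈ S, ∀ ν, z + Pi.single ν 1 ∈ S')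
    {z : Fin (d + 1) → ℤ} (hz : z ∉ S') :
    ∑ ν, (n : ℂ) * (f (z - Pi.single ν 1) ν - f z ν) = 0 := by
  refine Finset.sum_eq_zero fun ν _ => ?_
  have h1 : f z ν = 0 := hfS z (fun h => hz (hSS' h)) ν
  have h2 : f (z - Pi.single ν 1) ν = 0 := by
    refine hfS _ (fun h => hz ?_) ν
    have := hshift _ h ν
    rwa [sub_add_cancel] at this
  rw [h1, h2, sub_zero, mul_zero]

/-! ## §2 `∂^η_μ G_k(0) ∂^{η*}` on bounded data: the pointwise bound under the row hypothesis of (1.10) -/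

/-- ★★ **THE BLOCK-MASS RIESZ BOUND, POINTWISE FORM**: with the weighted row bound of `∂^η_μG_k(0)(x,·)`
(`B4Thm19ZeroLattice.GkLat_weightedRowD_le` at `(k, a, m², μ, x)`), for every bounded bond function `f` (`‖f(z,ν)‖ ≤ F_∞`) the
series `(∂^η_μG_k(0)∂^{η*}f)(x) = Σ_z n(G_k(0)(x+e_μ,z) − G_k(0)(x,z))·(∂^{η*}f)(z)` converges absolutely and
`‖(∂^η_μG_k(0)∂^{η*}f)(x)‖ ≤ c₀·2(d+1)·n·F_∞` (`n = L^k`). No box, no `log N`.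
[cite: Balaban1983RegularityDecay, Theorem (Prop. 2.1 of [1]) (1.10) p.573, derivative clause; dictionary (Ω = ηℤ^{d+1}, A = 0, data ∂^{η*}f)] -/
theorem norm_derivG_adjDiv_tsum_le {ℓ k : ℕ} {a m2 δ₀ c₀ : ℝ} {μ : Fin (d + 1)} {x : Fin (d + 1) → ℤ}
    (hF : ∀ F : Finset (Fin (d + 1) → ℤ),
      ∑ z ∈ F, |(((ℓ + 1) ^ k : ℕ) : ℝ) * (GkLat ℓ k a m2 (x + Pi.single μ 1) z - GkLat ℓ k a m2 x z)|
        * Real.exp (δ₀ * supNorm (x - z) / (((ℓ + 1) ^ k : ℕ) : ℝ)) ≤ c₀)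
    (hδ₀ : 0 ≤ δ₀) {f : (Fin (d + 1) → ℤ) → Fin (d + 1) → ℂ} {Fsup : ℝ} (hf : ∀ z ν, ‖f z ν‖ ≤ Fsup) :
    (Summable fun z =>
        (((((ℓ + 1) ^ k : ℕ) : ℝ) * (GkLat ℓ k a m2 (x + Pi.single μ 1) z - GkLat ℓ k a m2 x z) : ℝ) : ℂ) *
          ∑ ν, (((ℓ + 1) ^ k : ℕ) : ℂ) * (f (z - Pi.single ν 1) ν - f z ν)) ∧
      ‖∑' z, (((((ℓ + 1) ^ k : ℕ) : ℝ) * (GkLat ℓ k a m2 (x + Pi.single μ 1) z - GkLat ℓ k a m2 x z) : ℝ) : ℂ) *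
          ∑ ν, (((ℓ + 1) ^ k : ℕ) : ℂ) * (f (z - Pi.single ν 1) ν - f z ν)‖
        ≤ c₀ * (2 * ((d : ℝ) + 1) * (((ℓ + 1) ^ k : ℕ) : ℝ) * Fsup) := by
  have hg : ∀ z, ‖∑ ν, (((ℓ + 1) ^ k : ℕ) : ℂ) * (f (z - Pi.single ν 1) ν - f z ν)‖
      ≤ 2 * ((d : ℝ) + 1) * (((ℓ + 1) ^ k : ℕ) : ℝ) * Fsup := norm_adjDiv_le ((ℓ + 1) ^ k) hf
  have h := GkLatD_apply_le hF hδ₀ (f := fun z => ∑ ν, (((ℓ + 1) ^ k : ℕ) : ℂ) * (f (z - Pi.single ν 1) ν - f z ν))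
    (D := 0) hg (fun z _ => supNorm_nonneg (x - z))
  simpa only [mul_zero, zero_div, neg_zero, Real.exp_zero, mul_one] using h

/-! ## §3 The existential form: one constant for all `k ≥ 1` and the whole window -/

/-- ★★★ **`∂^η G_k(0) ∂^{η*} : ℓ^∞ → ℓ^∞` WITH NO `log N`** (the block-mass shadow of the Coulomb chart, flat): for `d`,
`L = ℓ+1 ≥ 2` and a window `a ∈ [a₋,a₊]` (`a₋ > 0`), `m² ∈ [0,m²₊]` there is `C > 0` such that for every `k ≥ 1`, every window
point, every axis `μ`, site `x` and bounded bond function `f` (`‖f(z,ν)‖ ≤ F_∞`):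
`‖(∂^η_μ G_k(0) ∂^{η*}f)(x)‖ ≤ C·n·F_∞`, `n = L^k` (`C = 2(d+1)c₀`). At one level (`k = 1`): `≤ C·L·F_∞`. The true norm is
`≍ log n`; the factor `n` is this file's crude bookkeeping of `‖∂^{η*}‖_{∞→∞} ≤ 2(d+1)n`.
[cite: Balaban1983RegularityDecay, Theorem (Prop. 2.1 of [1]) (1.10) p.573, derivative clause; Balaban1984PropagatorsII, (1.9) p.226] -/
theorem exists_norm_derivG_adjDiv_le (d ℓ : ℕ) (hℓ : 1 ≤ ℓ) (amin aplus m2plus : ℝ) (ha : 0 < amin) :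
    ∃ C : ℝ, 0 < C ∧ ∀ (k : ℕ), 1 ≤ k → ∀ (a m2 : ℝ), amin ≤ a → a ≤ aplus → 0 ≤ m2 → m2 ≤ m2plus →
      ∀ (μ : Fin (d + 1)) (x : Fin (d + 1) → ℤ) (f : (Fin (d + 1) → ℤ) → Fin (d + 1) → ℂ) (Fsup : ℝ),
        (∀ z ν, ‖f z ν‖ ≤ Fsup) →
        (Summable fun z =>
            (((((ℓ + 1) ^ k : ℕ) : ℝ) * (GkLat ℓ k a m2 (x + Pi.single μ 1) z - GkLat ℓ k a m2 x z) : ℝ) : ℂ) *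
              ∑ ν, (((ℓ + 1) ^ k : ℕ) : ℂ) * (f (z - Pi.single ν 1) ν - f z ν)) ∧
          ‖∑' z, (((((ℓ + 1) ^ k : ℕ) : ℝ) * (GkLat ℓ k a m2 (x + Pi.single μ 1) z - GkLat ℓ k a m2 x z) : ℝ) : ℂ) *
              ∑ ν, (((ℓ + 1) ^ k : ℕ) : ℂ) * (f (z - Pi.single ν 1) ν - f z ν)‖
            ≤ C * (((ℓ + 1) ^ k : ℕ) : ℝ) * Fsup := by
  obtain ⟨δ₀, c₀, hδ₀, hc₀, h⟩ := GkLat_weightedRowD_le d ℓ hℓ amin aplus m2plus ha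
  refine ⟨c₀ * (2 * ((d : ℝ) + 1)), by positivity, ?_⟩
  intro k hk a m2 h1 h2 h3 h4 μ x f Fsup hf
  have hmain := norm_derivG_adjDiv_tsum_le (h k hk a m2 h1 h2 h3 h4 μ x) hδ₀.le hf
  exact ⟨hmain.1, hmain.2.trans (le_of_eq (by ring))⟩

/-! ## §4 The solution form on finitely supported data -/

/-- ★★ **THE GRADIENT OF THE SOLUTION, FINITELY SUPPORTED DATA**: `k ≥ 1`, `a > 0`, `m² ≥ 0`; `f` a bond function with
`f(z,ν) = 0` off `S`, `S' ⊇ S` closed under `z ↦ z + e_ν` from `S`, `‖f‖ ≤ F_∞`; `g := ∂^{η*}f` (supported in `S'`) and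
`h(z) := Σ_{x′ ∈ S'} G_k(0)(z,x′)·g(x′)`. Then `h` solves `(−Δ^ξ + m² + a_kQ_k^*Q_k)h = g` on all of `ℤ^{d+1}`
(`B4Thm110ZeroLattice.GkLat_apply_finsupp`) and, under the row bound of (1.10) at `(μ, x)`,
`‖n(h(x+e_μ) − h(x))‖ ≤ c₀·2(d+1)·n·F_∞` — independent of `S`, `S'` (NO `log N`).
[cite: Balaban1983RegularityDecay, Theorem (Prop. 2.1 of [1]) (1.10) p.573, (2.44) p.584; dictionary (Ω = ηℤ^{d+1}, A = 0, data ∂^{η*}f)] -/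
theorem blockMass_solution_gradient_le {ℓ k : ℕ} (hℓ : 1 ≤ ℓ) (hk : 1 ≤ k) {a m2 δ₀ c₀ : ℝ} (ha : 0 < a) (hm : 0 ≤ m2)
    {μ : Fin (d + 1)} {x : Fin (d + 1) → ℤ}
    (hF : ∀ F : Finset (Fin (d + 1) → ℤ),
      ∑ z ∈ F, |(((ℓ + 1) ^ k : ℕ) : ℝ) * (GkLat ℓ k a m2 (x + Pi.single μ 1) z - GkLat ℓ k a m2 x z)|
        * Real.exp (δ₀ * supNorm (x - z) / (((ℓ + 1) ^ k : ℕ) : ℝ)) ≤ c₀)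
    (hδ₀ : 0 ≤ δ₀) {f : (Fin (d + 1) → ℤ) → Fin (d + 1) → ℂ} {S S' : Finset (Fin (d + 1) → ℤ)}
    (hfS : ∀ z ∉ S, ∀ ν, f z ν = 0) (hSS' : S ⊆ S') (hshift : ∀ z ∈ S, ∀ ν, z + Pi.single ν 1 ∈ S')
    {Fsup : ℝ} (hf : ∀ z ν, ‖f z ν‖ ≤ Fsup) :
    (∀ y, opD ((ℓ + 1) ^ k) (B1.aSeq a ((ℓ : ℝ) + 1) k) m2
        (fun z => ∑ x' ∈ S', ((GkLat ℓ k a m2 z x' : ℝ) : ℂ) *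
          ∑ ν, (((ℓ + 1) ^ k : ℕ) : ℂ) * (f (x' - Pi.single ν 1) ν - f x' ν)) y
        = ∑ ν, (((ℓ + 1) ^ k : ℕ) : ℂ) * (f (y - Pi.single ν 1) ν - f y ν)) ∧
      ‖(((ℓ + 1) ^ k : ℕ) : ℂ) *
          ((∑ x' ∈ S', ((GkLat ℓ k a m2 (x + Pi.single μ 1) x' : ℝ) : ℂ) *
              ∑ ν, (((ℓ + 1) ^ k : ℕ) : ℂ) * (f (x' - Pi.single ν 1) ν - f x' ν)) -
            ∑ x' ∈ S', ((GkLat ℓ k a m2 x x' : ℝ) : ℂ) *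
              ∑ ν, (((ℓ + 1) ^ k : ℕ) : ℂ) * (f (x' - Pi.single ν 1) ν - f x' ν))‖
        ≤ c₀ * (2 * ((d : ℝ) + 1) * (((ℓ + 1) ^ k : ℕ) : ℝ) * Fsup) := by
  set g : (Fin (d + 1) → ℤ) → ℂ := fun z => ∑ ν, (((ℓ + 1) ^ k : ℕ) : ℂ) * (f (z - Pi.single ν 1) ν - f z ν) with hgdef
  have hg0 : ∀ z ∉ S', g z = 0 := fun z hz => adjDiv_eq_zero_of_support ((ℓ + 1) ^ k) hfS hSS' hshift hz
  refine ⟨fun y => (GkLat_apply_finsupp hℓ hk ha hm S' hg0).2.2 y, ?_⟩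
  -- the gradient of `h` at `x` is the finite sum of the differenced kernel against `g`, = the full series
  set K : (Fin (d + 1) → ℤ) → ℂ := fun z =>
    (((((ℓ + 1) ^ k : ℕ) : ℝ) * (GkLat ℓ k a m2 (x + Pi.single μ 1) z - GkLat ℓ k a m2 x z) : ℝ) : ℂ) with hKdef
  have hfin : (((ℓ + 1) ^ k : ℕ) : ℂ) *
      ((∑ x' ∈ S', ((GkLat ℓ k a m2 (x + Pi.single μ 1) x' : ℝ) : ℂ) * g x') -
        ∑ x' ∈ S', ((GkLat ℓ k a m2 x x' : ℝ) : ℂ) * g x') = ∑ x' ∈ S', K x' * g x' := by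
    rw [← Finset.sum_sub_distrib, Finset.mul_sum]
    refine Finset.sum_congr rfl fun x' _ => ?_
    simp only [hKdef]; push_cast; ring
  have htsum : ∑' z, K z * g z = ∑ x' ∈ S', K x' * g x' :=
    tsum_eq_sum fun z hz => by rw [hg0 z hz, mul_zero]
  have hb := (norm_derivG_adjDiv_tsum_le hF hδ₀ hf).2
  rw [hfin, ← htsum]
  exact hb

end Summit.QuantumFields.YangMills.Theorems.PoincareLipschitzFlatBlockMassRiesz
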